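import Literature.Computability.AlgebraicComplexity.BLMW11InvariantDimensionTransport
import Literature.Computability.AlgebraicComplexity.PlethysmLifting
import Literature.Computability.Complexity.OccurrenceObstructionsBIP
import HarnessLib

/-!
# BLMW 2011, Prop. 5.5.2 at degree `δ = 0`: the UNGUARDED typed sentences of (5.5.2)/(5.5.3) are
# false (plethysm junk at inner degree `0`) — certificate for the cell's ERRATUM A19

Cell `val-lit` (D-0074 GROUP L), row BLMW11-A; ERRATUM evidence (typing drift, NOT a print
erratum). P. Bürgisser, J. M. Landsberg, L. Manivel, J. Weyman, SIAM J. Comput. 40(4) (2011), §5.5,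
Def. 5.5.1 and Prop. 5.5.2: `mult_π = ½ ∑_{μ ≠ ν} k_{πμν} p_μ p_ν + ∑_μ sk^π_{μμ} C(p_μ + 1, 2)`,
`p_μ = dim (S_μE)_0^{𝔚_E}` = the multiplicity of `S_μE` in `S^m(S^δE)` (Cor. 8.4.2), and
"`ℂ[GL(W)·per_m] = ⊕_{π ∈ Σ_{per_m}} (S_πW^*)^{⊕ mult_π}`" ((5.5.2)),
"`ℂ[\overline{GL(W)·per_m}]_δ ⊆ ⊕ (S_πW^*)^{⊕ mult_π}`" ((5.5.3)). In degree `δ = 0` the print is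
consistent: `π = ∅`, `p_∅ = 1` (the trivial module), `mult_∅ = sk^∅_{∅∅} C(2,2) = 1` = the
multiplicity of the constants. The tree's typing (`BLMW11StabilityInheritance.lean`) renders `p_μ` by
`plethysmCoeffOfPartition ℂ m δ μ`, whose value at inner degree `δ = 0` is the documented `finrank`
JUNK `0` (`SchurWeylPlethysm.lean`: "`k[Sym^0] = k[X]` carries the trivial action and
`plethysmCoeff k σ 0 0` is junk `0`"; the same defect was found and guarded in `DIP20_lem_3_4`,
`DIP20MultiplicityObstructions.lean`, bip referee rows 70/73), so the typed `BLMW2011.multPer ℂ m 0 ∅`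
is `0` while the left sides of both typed facts are `1` at `δ = 0`. As first typed (before ERRATUM A19)
the named facts quantified over all `δ : ℕ` without the guard `0 < δ` that `BLMW2011_cor_8_4_2`
carries; those unguarded sentences are false, which this file certifies.

PROVED here (theorems only; no definitions, no named facts):

* `plethysmCoeff_zero_eq_zero`: `plethysmCoeff ℂ (Fin N) 0 χ = 0` for `N ≠ 0` and every weight `χ`
  (the argument of the private `not_plethysmCoeff_zero_pos` of `DIP20MultiplicityObstructions.lean`,
  for any `N ≥ 1`: a nonzero highest-weight vector of `k[Sym^0 k^N] = k[X]` has weight `0`, and then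
  all powers `X^j` are highest-weight vectors — an infinite independent family);
* `multPer_zero_eq_zero`: `BLMW2011.multPer ℂ m 0 π = 0` (`m ≠ 0`);
* `perOrbitCeiling_zero_pos`: `0 < perOrbitCeiling ℂ m 0 π` (the constant `1 × 1` coefficient matrix
  lies in the bound space: words of length `0`);
* `multPerPadded_zero_eq_zero`: `BLMW2011.multPerPadded ℂ m n 0 π = 0` (`m ≠ 0`) — the padded
  bound of Prop. 5.6.2 has the same junk at `δ = 0`;
* `not_unguarded_per_invariants_formula` (at `m = 3`, `δ = 0`, `π = ∅`, through t03's
  `perOrbitCeiling_eq_finrank_subgroupInvariants`) and `not_unguarded_per_closure_bound` (at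
  `m = 3`, `δ = 0`: the trivial type occurs in `ℂ[\overline{GL·per_3}]`, tree
  `Complexity.hasHighestWeight_orbitCoordRep_zero` with `orbitMultiplicity_pos_iff_hasHighestWeight`,
  against the typed bound `multPer ℂ 3 0 ∅ = 0`): the negations of the UNGUARDED sentences, spelled
  out VERBATIM as the bodies of `BLMW2011_prop_5_5_2_invariants` (first conjunct) and
  `BLMW2011_prop_5_5_2_closure` read before the cell's ERRATUM A19 — deliberately not by name, so
  that this certificate does not pin those definitions while they are re-typed with the guard
  `0 < δ` (first landing of this file, p445232, named them; superseded here).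

The CORRECTED statements carry `0 < δ` (as `BLMW2011_cor_8_4_2` and `DIP20_lem_3_4` do); their
re-typing is the BLMW row owner's ruling (cell bus), and the positive-degree identity
`perOrbitCeiling ℂ m δ π = multPer ℂ m δ π` (`0 < δ`, `m ≥ 3`) is the content of Prop. 5.5.2 to be
proved separately. Honest framing: bookkeeping about a junk value of a tree definition; VP ≠ VNP is
NOT proved and nothing here is progress on it.

## References

* [BurgisserEtAl2011] BLMW 2011, §5.5 Def. 5.5.1, Prop. 5.5.2 (5.5.2)–(5.5.3); §8.4 Cor. 8.4.2.
* Tree: `SchurWeylPlethysm.lean` (`plethysmCoeff`, junk at inner degree `0`),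
  `DIP20MultiplicityObstructions.lean` (`DIP20_lem_3_4`, guard `0 < d`),
  `BLMW11InvariantDimensionTransport.lean` (`perOrbitCeiling_eq_finrank_subgroupInvariants`),
  `BLMW11PerOrbitCeiling.lean` (`perOrbitCeiling`).
-/

noncomputable section

open MvPolynomial

namespace Literature.Computability.AlgebraicComplexity

open _root_.Literature.NumberTheory.DiophantineGeometry
open _root_.Literature.RepresentationTheory.GeneralLinear

/-- **Inner degree `0`: every plethysm coefficient of the tree is the `finrank` junk `0`**
(`N ≥ 1`, any weight): a nonzero highest-weight vector of `k[Sym^0 k^N] = k[X]` (trivial action) has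
weight `0`, and then `1, X, X², …` is an infinite independent family of highest-weight vectors, so the
space is infinite-dimensional and `Module.finrank = 0`. The tree's documented junk convention
(`plethysmCoeff`, `SchurWeylPlethysm.lean`); argument of the private `not_plethysmCoeff_zero_pos` of
`DIP20MultiplicityObstructions.lean`. [folklore] -/
private theorem plethysmCoeff_zero_eq_zero {N : ℕ} (hN : N ≠ 0) (χ : Weight (Fin N)) :
    plethysmCoeff ℂ (Fin N) 0 χ = 0 := by
  classical
  by_contra hne
  have hμ : 0 < plethysmCoeff ℂ (Fin N) 0 χ := Nat.pos_of_ne_zero hne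
  unfold plethysmCoeff hwMultiplicity at hμ
  haveI : Module.Finite ℂ ↥(highestWeightSpace (coordRep (Fin N) ℂ 0) χ) :=
    Module.finite_of_finrank_pos hμ
  obtain ⟨F, hF0⟩ := Module.finrank_pos_iff_exists_ne_zero.mp hμ
  -- the torus acts trivially in inner degree `0`, so a nonzero weight vector has weight `0`
  have hχ : χ = 0 := by
    obtain ⟨s, hs⟩ := support_nonempty.mpr fun h => hF0 (Subtype.ext h)
    rw [← monWeight_eq_of_mem_weightSpace (highestWeightSpace_le_weightSpace _ _ F.2) hs]
    funext i
    refine monWeight_apply_eq_zero s fun d _ => ?_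
    have hd : d.1.degree = 0 := mem_degMonomials_iff.mp d.2
    rw [Finsupp.degree_eq_zero_iff] at hd
    rw [hd, Finsupp.zero_apply]
  obtain ⟨N', rfl⟩ := Nat.exists_eq_succ_of_ne_zero hN
  let d : DegIdx (Fin (N' + 1)) 0 := ⟨0, by rw [mem_degMonomials_iff]; rfl⟩
  have hX : ∀ j : ℕ, (X d : MvPolynomial (DegIdx (Fin (N' + 1)) 0) ℂ) ^ j ∈
      highestWeightSpace (coordRep (Fin (N' + 1)) ℂ 0) χ := by
    intro j
    have h1 := Complexity.X_mem_highestWeightSpace_coordRep (k := ℂ) 0 (Fin.last N')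
      (fun i => Fin.le_last i) d (by simp [d])
    have h2 := pow_mem_highestWeightSpace_coordRep h1 j
    have hw : j • (Pi.single (Fin.last N') (-((0 : ℕ) : ℤ)) : Weight (Fin (N' + 1))) = χ := by
      rw [hχ]; simp
    rwa [hw] at h2
  have hli : LinearIndependent ℂ
      (fun j : ℕ => (⟨X d ^ j, hX j⟩ : ↥(highestWeightSpace (coordRep (Fin (N' + 1)) ℂ 0) χ))) := by
    apply LinearIndependent.of_comp (highestWeightSpace (coordRep (Fin (N' + 1)) ℂ 0) χ).subtype
    have hfun : (⇑(highestWeightSpace (coordRep (Fin (N' + 1)) ℂ 0) χ).subtype ∘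
        fun j : ℕ => (⟨X d ^ j, hX j⟩ : ↥(highestWeightSpace (coordRep (Fin (N' + 1)) ℂ 0) χ))) =
        fun j : ℕ => MvPolynomial.basisMonomials (DegIdx (Fin (N' + 1)) 0) ℂ (Finsupp.single d j) := by
      funext j
      simp [MvPolynomial.coe_basisMonomials, X_pow_eq_monomial]
    rw [hfun]
    exact (MvPolynomial.basisMonomials _ ℂ).linearIndependent.comp _ (Finsupp.single_injective d)
  exact Module.Finite.not_linearIndependent_of_infinite _ hli

/-- **At `δ = 0` the typed `mult_π` is `0`** (`m ≠ 0`): `partsLE m 0 = {∅}`, `p_∅ = 0` (junk), so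
every summand of `multPerTwice` and `multPerOmitted` vanishes (`C(1,2) = C(0,2) = 0`). In print
`mult_∅ = 1`. [cite: BurgisserEtAl2011, Def. 5.5.1] -/
theorem multPer_zero_eq_zero {m : ℕ} (hm : m ≠ 0) (π : Nat.Partition (m * 0)) :
    BLMW2011.multPer ℂ m 0 π = 0 := by
  classical
  haveI : Subsingleton (Nat.Partition (m * 0)) := (inferInstance : Subsingleton (Nat.Partition 0))
  have hp : ∀ μ : Nat.Partition (m * 0), plethysmCoeffOfPartition ℂ m 0 μ = 0 := fun μ =>
    plethysmCoeff_zero_eq_zero hm _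
  unfold BLMW2011.multPer BLMW2011.multPerPrinted BLMW2011.multPerTwice BLMW2011.multPerOmitted
  simp [hp, Subsingleton.elim _ π]

/-- A partition of `m * 0` has no parts. [folklore] -/
private theorem parts_eq_zero_of_mul_zero {m : ℕ} (π : Nat.Partition (m * 0)) : π.parts = 0 := by
  haveI : Subsingleton (Nat.Partition (m * 0)) := (inferInstance : Subsingleton (Nat.Partition 0))
  rw [Subsingleton.elim π (Nat.Partition.indiscrete (m * 0))]
  rfl

/-- The (dual) weight of a partition of `m * 0` is the zero weight. [folklore] -/
private theorem dualOfPartition_of_mul_zero {m N : ℕ} (π : Nat.Partition (m * 0)) :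
    Weight.dualOfPartition N π = 0 := by
  have h : Weight.ofPartition N π = 0 := by
    funext i
    rw [Weight.ofPartition, Nat.Partition.sortedParts, parts_eq_zero_of_mul_zero]
    simp
  rw [Weight.dualOfPartition, h]
  funext i
  simp [Weight.dual]

/-- Words of length `m * 0` are all equal (the empty word). [folklore] -/
private theorem word_mul_zero_subsingleton {N m : ℕ} : Subsingleton (Word N (m * 0)) :=
  (inferInstance : Subsingleton (Word N 0))

/-- `GL_N` acts trivially on words of length `m * 0` (`(k^N)^{⊗0} = k`). [folklore] -/
private theorem wordRep_mul_zero {N m : ℕ} (g : GL (Fin N) ℂ) (c : Word N (m * 0) → ℂ) :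
    wordRep ℂ N (m * 0) g c = c := by
  haveI : Subsingleton (Word N (m * 0)) := word_mul_zero_subsingleton
  funext w
  rw [wordRep_apply, Finset.sum_eq_single w]
  · haveI : IsEmpty (Fin (m * 0)) := (inferInstance : IsEmpty (Fin 0))
    rw [Finset.univ_eq_empty, Finset.prod_empty, one_mul]
  · intro u _ hu; exact absurd (Subsingleton.elim u w) hu
  · intro h; exact absurd (Finset.mem_univ w) h


/-- **At `δ = 0` the per-side ceiling is positive**: the constant coefficient matrix on the (single,
empty) pair of words lies in the bound space `T` of `perOrbitCeiling ℂ m 0 π` (it is `𝔖_0`-invariant,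
its column is a transposed weight vector of the zero weight `π^* = 0`, its row is fixed by the
stabilizing family — all actions on words of length `0` are trivial). In fact `perOrbitCeiling ℂ m 0 ∅
= 1 = mult_∅` in print. [cite: BurgisserEtAl2011, Prop. 5.5.2] -/
theorem perOrbitCeiling_zero_pos {m : ℕ} (π : Nat.Partition (m * 0)) : 0 < perOrbitCeiling ℂ m 0 π := by
  classical
  unfold perOrbitCeiling
  apply Module.finrank_pos_iff_exists_ne_zero.mpr
  refine ⟨⟨fun _ _ => 1, ?_, ?_, ?_⟩, ?_⟩
  · intro τ; rfl
  · intro J b hb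
    rw [dualOfPartition_of_mul_zero, wordRep_mul_zero]
    simp [weightChar]
  · intro I h hh
    exact wordRep_mul_zero h _
  · haveI : Unique (Word (m * m) (m * 0)) := (inferInstance : Unique (Word (m * m) 0))
    intro h
    have := congrArg (fun L : ↥(boundSpace ℂ (Weight.dualOfPartition (m * m) π)
      (perStabInvariants ℂ m (m * 0))) => (L : Matrix (Word (m * m) (m * 0)) (Word (m * m) (m * 0)) ℂ)
        default default) h
    simp at this

/-- **At `δ = 0` the typed `mult^n_π` is `0`** (`m ≠ 0`): `multPerPadded ℂ m n 0 π` is a sum of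
values `multPer ℂ m 0 π'`, all `0` (`multPer_zero_eq_zero`). In print `mult^n_∅ = mult_∅ = 1`; so the
typed `BLMW2011_prop_5_6_2_closure` needs the guard `0 < δ` as well (ERRATUM A19 scope).
[cite: BurgisserEtAl2011, Def. 5.6.1] -/
theorem multPerPadded_zero_eq_zero {m : ℕ} (hm : m ≠ 0) (n : ℕ) (π : Nat.Partition (n * 0)) :
    BLMW2011.multPerPadded ℂ m n 0 π = 0 := by
  classical
  unfold BLMW2011.multPerPadded
  exact Finset.sum_eq_zero fun π' _ => multPer_zero_eq_zero hm π'

/-- **The UNGUARDED dimension formula of (5.5.2) is false at `δ = 0`** — witness `m = 3`, `δ = 0`,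
`π = ∅`: the sentence displayed here is VERBATIM the first conjunct of the named fact
`BLMW2011_prop_5_5_2_invariants` as typed before ERRATUM A19 (cell `val-lit`, 2026-08-26; the
corrected typing inserts `0 < δ →`); it is spelled out rather than named so that this certificate
does not pin the definition. At `δ = 0` the left side is `perOrbitCeiling ℂ 3 0 ∅ ≥ 1`
(`perOrbitCeiling_eq_finrank_subgroupInvariants`, `perOrbitCeiling_zero_pos`) and the right side is
the junk `multPer ℂ 3 0 ∅ = 0`. The PRINT is right at `δ = 0` (both sides `1`).
[cite: BurgisserEtAl2011, Prop. 5.5.2 (5.5.2)] -/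
theorem not_unguarded_per_invariants_formula :
    ¬ ∀ (m δ : ℕ) [NeZero m] (π : Nat.Partition (m * δ)), 3 ≤ m → π.parts.card ≤ m * m →
      Module.finrank ℂ (subgroupInvariants (schurRep (stdRep (MatIdx m) ℂ) π)
        (linStabilizer (paddedPerFormLex ℂ m m))) = BLMW2011.multPer ℂ m δ π := by
  intro h
  have hπ : (Nat.Partition.indiscrete (3 * 0)).parts.card ≤ 3 * 3 := by
    rw [parts_eq_zero_of_mul_zero]; simp
  have h3 := h 3 0 (Nat.Partition.indiscrete (3 * 0)) le_rfl hπ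
  rw [← perOrbitCeiling_eq_finrank_subgroupInvariants 3 le_rfl _ hπ,
    multPer_zero_eq_zero (by norm_num)] at h3
  exact (perOrbitCeiling_zero_pos (Nat.Partition.indiscrete (3 * 0))).ne' h3

/-- **The UNGUARDED closure bound of (5.5.3) is false at `δ = 0`** — witness `m = 3`, `δ = 0`,
`π = ∅`: the sentence is VERBATIM the body of `BLMW2011_prop_5_5_2_closure` as typed before
ERRATUM A19 (spelled out, not named, for the same reason). The trivial type `0 = ∅^*` occurs in
`ℂ[\overline{GL(W)·per_3}]` (the constants; tree `Complexity.hasHighestWeight_orbitCoordRep_zero`,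
positivity by `orbitMultiplicity_pos_iff_hasHighestWeight`), while the typed bound is
`multPer ℂ 3 0 ∅ = 0`; in print (5.5.3) at `δ = 0` reads `1 ≤ 1`.
[cite: BurgisserEtAl2011, Prop. 5.5.2 (5.5.3)] -/
theorem not_unguarded_per_closure_bound :
    ¬ ∀ (m δ : ℕ) [NeZero m] (π : Nat.Partition (m * δ)), 3 ≤ m → π.parts.card ≤ m * m →
      orbitMultiplicity ℂ (paddedPerFormLex ℂ m m) m (Weight.dualOfPartition (m * m) π).toMatIdx ≤
        BLMW2011.multPer ℂ m δ π := by
  intro h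
  have hπ : (Nat.Partition.indiscrete (3 * 0)).parts.card ≤ 3 * 3 := by
    rw [parts_eq_zero_of_mul_zero]; simp
  have h3 := h 3 0 (Nat.Partition.indiscrete (3 * 0)) le_rfl hπ
  rw [multPer_zero_eq_zero (by norm_num), Nat.le_zero] at h3
  have hpos : 0 < orbitMultiplicity ℂ (paddedPerFormLex ℂ 3 3) 3
      (Weight.dualOfPartition (3 * 3) (Nat.Partition.indiscrete (3 * 0))).toMatIdx := by
    haveI : Infinite ℂ := CharZero.infinite ℂ
    rw [orbitMultiplicity_pos_iff_hasHighestWeight _ (by norm_num)]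
    have h0 : (Weight.dualOfPartition (3 * 3) (Nat.Partition.indiscrete (3 * 0))).toMatIdx =
        (0 : Weight (MatIdx 3)) := by
      rw [dualOfPartition_of_mul_zero]; rfl
    rw [h0]
    exact Complexity.hasHighestWeight_orbitCoordRep_zero _ 3
  exact hpos.ne' h3

end Literature.Computability.AlgebraicComplexity
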